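import Summits.ABC.IUTFork.Repair.CandMochizuki7RamEDeepPins
import Summits.ABC.IUTFork.Cor312RamifiedEBoxIndex
import HarnessLib

/-!
# IUT REPAIR BRANCH (rung LADDER-ABC:A2.RP) — on the honest ramified bed the Corollary's two region pins EXCLUDE the OBJECT sentence,
# for EVERY reading of Ism inside `GL(I)`, every ramification index `e`, every depth `m ≥ 1`, every region reading `ρ`

Proof-only record file (D-0012; no definitions, no `Prop` fact; adjudication-closure files IMPORTED, not edited) of the abc-iut cell, seat abc-iut-rp-m1 (gen 5;
class (ii)). TAKES NO SIDE on [IUTchIII] Cor. 3.12 or on any author; typed ≠ proved. Over `Repair/CandMochizuki7RamEIsoPins` / `…IsoFull` / `…DeepPins` (the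
reading-generic honest bed RAM_{e;G₁,G₂}^H(p, m), its full situation with the typed Thm 3.11, the deep-data no-go) and `Cor312RamifiedEBoxIndex` (the BOX-INDEX
INVARIANT: no element of ⟨(Ind1)∪(Ind2)⟩ of `GL(I)` maps a polydisc onto a different polydisc).

THE ARGUMENT. Under the Θ-pin and the q-pin (abc-iut-w5-d230's `PinnedRegions`, with the honest q-datum `{(π^m)_j}`) and Thm. 3.11 (ii) (b), the OBJECT
sentence `PilotKummerIndRelated` is READING R3 (`reading3_iff_pilotKummerIndRelated`): at label 2, `box m = Φ(box 4m)` for some indeterminacy `Φ` of the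
reading — and `image_box_eq_box_imp_eq` forbids it for `m ≥ 1`, WHATEVER the reading inside `GL(I)`. KERNEL CELLS (every prime `p`, every `e ≥ 1`,
every `m ≥ 1`, every reading `1 ∈ G₁, G₂ ⊆ GL(I)`):
* **`pins_exclude_object` — for every region reading `ρ`: `PinnedRegions ρ {(π^m)_j} → ¬ PilotKummerIndRelated ρ {(π^m)_j}`** (∀-reading, ∀-ρ, ∀-depth;
  supersedes the deep-data `not_object_of_pinned_deep` and the isometric `not_pilotKummerIndRelated_of_pinned_isometric`);
* `not_gapA3_of_pinned3` — for every THREE-pinned `ρ` the pinned schema `GapA3` is FALSE (non-vacuously);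
* **`Tc_object_unsat` — THE DIRECTOR'S T-c CONJUNCTION FOR H := THE OBJECT ITSELF, «typed Thm 3.11 (i)–(iii) ∧ PinnedRegions3 ∧ PilotKummerIndRelated», HAS
  NO MODEL on the honest ramified family**: among all readings of the strip-automorphisms / Ism inside `GL(I)`, all indices `e`, all depths `m ≥ 1` and all
  region readings `ρ` — although the typed Thm 3.11 holds on every such bed (`ramFullF_statement`), the pins are satisfiable on the isometric side
  (`pinnedRegions3_valRegionF`) and the OBJECT holds without pins on the Dupuy–Hilado side for `e > 4m` (gen 4's `ramEH_object_model`).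
READING (neutral): on the ramified toy, «pins» and «OBJECT» are each satisfiable but never together: the frozen pins read the pilots' regions off their Kummer
classes equivariantly, so the OBJECT becomes «an indeterminacy carries the Θ-polydisc `π^{4m}𝒪_L` onto the q-polydisc `π^m𝒪_L`», which no lattice
automorphism does (p-adic index). What a pinned OBJECT-model needs is an indeterminacy acting NON-integrally on the packet lattice — outside every reading of
Ism as automorphisms of `I`. Toy (`l⋇ = 2`, one place); no repair claimed; nothing here bears on [IUTchIII] Cor. 3.12. [claim: Mochizuki2012, status: disputed]
[cite: ScholzeStix2018, §2.2 pp. 9–10] [cite: DupuyHilado2025, §4.9]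
-/

noncomputable section

open Set

namespace Summit.ABC.IUTFork.Repair.CandMochizuki7RamE

open Thm311 Cor312 Cor312.Checks Cor312.IdentifiedNonVacuity Cor312Vol Cor312Vol.NaiveWitness Cor312Vol.PinnedWitness
  Cor312Vol.RamifiedEWitness Literature.IUT.LogThetaLattice

variable (p e : ℕ) {G₁ G₂ : Set ((Fin e → ℚ) ≃ₗ[ℚ] (Fin e → ℚ))}
  (h₁ : LinearEquiv.refl ℚ (Fin e → ℚ) ∈ G₁) (h₂ : LinearEquiv.refl ℚ (Fin e → ℚ) ∈ G₂) [NeZero e] [hp : Fact p.Prime] (m : ℕ)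
  (hG₁ : G₁ ⊆ latticeAuts p e) (hG₂ : G₂ ⊆ latticeAuts p e)

/-- The (Ind3)-enlarged Θ-region of the honest bed at label `j` is `box (m·j²)`. [folklore] -/
theorem ramSettingWithH_thetaRegion3 (j : toyIndex.Label) (vQ : toyIndex.VQ) :
    (ramSettingWithH p e G₁ G₂ h₁ h₂ m).thetaRegion3 j vQ = box p e j vQ ((m : ℤ) * jsq j) := by
  show (⋃ m' : ℤ, (ramSettingWithH p e G₁ G₂ h₁ h₂ m).thetaRegion m' j vQ) = _
  simp_rw [ramSettingWithH_thetaRegion]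
  exact Set.iUnion_const _

include hG₁ hG₂

/-- **THE PINS EXCLUDE THE OBJECT — every reading inside `GL(I)`, every `e`, every `m ≥ 1`, every `ρ`.** Under the Θ-pin and the q-pin with the honest
q-datum, `PilotKummerIndRelated` would make the q-box `box m` at label 2 an indeterminacy-image of the Θ-box `box 4m`, against the box-index invariant.
[claim: Mochizuki2012, status: disputed] -/
theorem pins_exclude_object (hm : 1 ≤ m)
    (ρ : (∀ v : toyIndex.V, v ∈ toyIndex.Vbad → Set ((ramShellsE p e).StarPacket v)) →
      ∀ (j : toyIndex.Label) (vQ : toyIndex.VQ), Set ((ramShellsE p e).Packet j vQ))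
    (hpin : PinnedRegions (ramLatticeWithH p e G₁ G₂ h₁ h₂ m) (ramSettingWithH p e G₁ G₂ h₁ h₂ m) ρ (qDatumE p e m)) :
    ¬ PilotKummerIndRelated (ramLatticeWithH p e G₁ G₂ h₁ h₂ m) (ramSettingWithH p e G₁ G₂ h₁ h₂ m) ρ (qDatumE p e m) := fun hobj => by
  have hR3 := (reading3_iff_pilotKummerIndRelated _ _ ρ _ (kummerB_ramWithH p e G₁ G₂ h₁ h₂ m) hpin).2 hobj 2 ()
  obtain ⟨Φ, hΦ, hU⟩ := hR3
  rw [ramSettingWithH_thetaRegion3, ramSettingWithH_qRegion, if_neg (by decide)] at hU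
  have hj : jsq (2 : toyIndex.Label) = 4 := rfl
  rw [hj] at hU
  have hΦ' : Φ ∈ indG p e := closureWith_le hG₁ hG₂ hΦ
  have hk := image_box_eq_box_imp_eq hΦ' 2 () hU.symm
  have hm' : (1 : ℤ) ≤ m := by exact_mod_cast hm
  omega

/-- … hence for every THREE-pinned `ρ` the pinned schema `GapA3` is FALSE (non-vacuously). [claim: Mochizuki2012, status: disputed] -/
theorem not_gapA3_of_pinned3 (hm : 1 ≤ m)
    (ρ : (∀ v : toyIndex.V, v ∈ toyIndex.Vbad → Set ((ramShellsE p e).StarPacket v)) →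
      ∀ (j : toyIndex.Label) (vQ : toyIndex.VQ), Set ((ramShellsE p e).Packet j vQ))
    (hpin : PinnedRegions3 (ramLatticeWithH p e G₁ G₂ h₁ h₂ m) (ramSettingWithH p e G₁ G₂ h₁ h₂ m) ρ (qDatumE p e m)) :
    ¬ GapA3 (ramLatticeWithH p e G₁ G₂ h₁ h₂ m) (ramSettingWithH p e G₁ G₂ h₁ h₂ m) ρ (qDatumE p e m) := fun h =>
  pins_exclude_object p e h₁ h₂ m hG₁ hG₂ hm ρ hpin.1 ((gapA3_iff _ _ ρ _ (kummerB_ramWithH p e G₁ G₂ h₁ h₂ m)).1 h hpin)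

/-- **`Tc_object_unsat` — «typed Thm 3.11 ∧ PinnedRegions3 ∧ OBJECT» HAS NO MODEL ON THE HONEST RAMIFIED FAMILY** (every reading inside `GL(I)`, every `e`,
every `m ≥ 1`, every region reading `ρ`; honest q-datum), stated on the full bed RAM_{e;G₁,G₂}^F(p, m), where the typed Thm 3.11 HOLDS.
[claim: Mochizuki2012, status: disputed] -/
theorem Tc_object_unsat (hm : 1 ≤ m) :
    (ramFullF p e G₁ G₂ h₁ h₂ m).Statement ∧
      ∀ ρ, PinnedRegions3 (ramFullF p e G₁ G₂ h₁ h₂ m).toLatticeSituation (ramSettingF p e G₁ G₂ h₁ h₂ m) ρ (qDatumE p e m) →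
        ¬ PilotKummerIndRelated (ramFullF p e G₁ G₂ h₁ h₂ m).toLatticeSituation (ramSettingF p e G₁ G₂ h₁ h₂ m) ρ (qDatumE p e m) :=
  ⟨ramFullF_statement p e G₁ G₂ h₁ h₂ m, fun ρ hpin => pins_exclude_object p e h₁ h₂ m hG₁ hG₂ hm ρ hpin.1⟩

omit hG₁ hG₂ in
/-- **The two poles, packaged with the no-go** (`m ≥ 1`): under the Dupuy–Hilado reading `GL(I)` and under the isometric reading `isoKE` alike, typed Thm 3.11
holds and no pinned region reading satisfies the OBJECT; on the isometric side the pins ARE satisfiable (`valRegion`), on the Dupuy–Hilado side (`e > 4m`)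
the OBJECT IS satisfiable for every `ρ` — never both. [claim: Mochizuki2012, status: disputed] -/
theorem pins_object_poles (hm : 1 ≤ m) :
    (∀ ρ, PinnedRegions3 (ramFullF p e (latticeAuts p e) (latticeAuts p e) (refl_mem_latticeAuts p e) (refl_mem_latticeAuts p e) m).toLatticeSituation
          (ramSettingF p e (latticeAuts p e) (latticeAuts p e) (refl_mem_latticeAuts p e) (refl_mem_latticeAuts p e) m) ρ (qDatumE p e m) →
        ¬ PilotKummerIndRelated
          (ramFullF p e (latticeAuts p e) (latticeAuts p e) (refl_mem_latticeAuts p e) (refl_mem_latticeAuts p e) m).toLatticeSituation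
          (ramSettingF p e (latticeAuts p e) (latticeAuts p e) (refl_mem_latticeAuts p e) (refl_mem_latticeAuts p e) m) ρ (qDatumE p e m)) ∧
      PinnedRegions3 (ramFullF p e (isoKE p e) (isoKE p e) (refl_mem_isoKE p e) (refl_mem_isoKE p e) m).toLatticeSituation
          (ramSettingF p e (isoKE p e) (isoKE p e) (refl_mem_isoKE p e) (refl_mem_isoKE p e) m) (valRegion p e) (qDatumE p e m) ∧
      (∀ ρ, PinnedRegions3 (ramFullF p e (isoKE p e) (isoKE p e) (refl_mem_isoKE p e) (refl_mem_isoKE p e) m).toLatticeSituation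
          (ramSettingF p e (isoKE p e) (isoKE p e) (refl_mem_isoKE p e) (refl_mem_isoKE p e) m) ρ (qDatumE p e m) →
        ¬ PilotKummerIndRelated (ramFullF p e (isoKE p e) (isoKE p e) (refl_mem_isoKE p e) (refl_mem_isoKE p e) m).toLatticeSituation
          (ramSettingF p e (isoKE p e) (isoKE p e) (refl_mem_isoKE p e) (refl_mem_isoKE p e) m) ρ (qDatumE p e m)) ∧
      (4 * m < e → ∀ ρ, PilotKummerIndRelated (ramLatticeEH p e m) (ramSettingEH p e m) ρ (qDatumE p e m)) :=
  ⟨(Tc_object_unsat p e _ _ m subset_rfl subset_rfl hm).2,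
    pinnedRegions3_valRegionF p e _ _ m subset_rfl subset_rfl,
    (Tc_object_unsat p e _ _ m (isoKE_subset_latticeAuts p e) (isoKE_subset_latticeAuts p e) hm).2,
    fun h ρ => pilotKummerIndRelated_ramEH p e m h ρ⟩

end Summit.ABC.IUTFork.Repair.CandMochizuki7RamE

end
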